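import Literature.MathematicalPhysics.QuantumLattice.HubbardSliceSymbolXiIncrements
import Literature.Analysis.Calculus.ThirdOrderChainRule
import Literature.Analysis.Calculus.IteratedDifferenceBound
import HarnessLib

/-!
# The INCREMENT of the slice symbol between two band curves `u` and `u + w`: the order-three chain of
# `t ↦ Ψ̂(u t + w t) − Ψ̂(u t)` and its third differences — every term carries the piece `w` or one of its derivatives

Topic `MathematicalPhysics/QuantumLattice`; continues `HubbardSliceSymbolXiIncrements` (`‖Ψ̂⁽ⁱ⁾(ξ+y) − Ψ̂⁽ⁱ⁾(ξ)‖ ≤ K_{i+1}|y|`, `i ≤ 2`) and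
`Literature.Analysis.Calculus.ThirdOrderChainRule` (`norm_chain3_three_sub_le`).  In the telescoping of the slice propagator of a framed band
over the frame pieces (Benfatto–Giuliani–Mastropietro 2006, §3 (3.2)–(3.8)) the `m`-th increment along a grid line is
`t ↦ Ψ̂_ω(u(t) + w(t)) − Ψ̂_ω(u(t))` with `u` the partial band and `w = −Kₘ` the piece read along the line; its third differences are bounded by
the third derivative of the DIFFERENCE of the two order-three chains, in which every term carries a factor `|w|, |w₁|, |w₂|` or `|w₃|` — the
smallness of the piece at its own scale.  The increment of `Ψ̂‴` (constant `K₄`, `HubbardSliceSymbolSmoothXiFourth`) enters as a HYPOTHESIS here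
so that this file does not wait for it:

* `hasDerivAt_sliceSymbolFnXi_incr_chain` — the chain of the difference `Ψ̂∘(u+w) − Ψ̂∘u` (difference of two `hasDerivAt_chain3_comp` chains);
* **`norm_sliceSymbolFnXi_incr_deriv3_le`** — the pointwise bound of its third member: with `|u₁| ≤ D₁, |u₂| ≤ D₂, |u₃| ≤ D₃`, `|w| ≤ W₀, …, |w₃| ≤ W₃`,
  `≤ K₄W₀(D₁+W₁)³ + K₃W₁(3D₁² + 3D₁W₁ + W₁²) + 3(K₃W₀(D₁+W₁)(D₂+W₂) + K₂(D₁W₂ + W₁D₂ + W₁W₂)) + K₂W₀(D₃+W₃) + K₁W₃`;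
* **`norm_fwdDiff_iter_three_sliceSymbolFnXi_incr_le`** — hence the same bound times `δ³` for `‖Δ_δ³(Ψ̂∘(u+w) − Ψ̂∘u)(t)‖` (`δ ≥ 0`).

Everything is proved; no definitions; no named facts.

## Sources

G. Benfatto, A. Giuliani, V. Mastropietro, Ann. Henri Poincaré 7 (2006) 809–898, (2.36aa), §3 (3.2)–(3.8) (`BenfattoGiulianiMastropietro2006`);
M. Salmhofer, *Renormalization* (1999), §4.2.5 (4.70) (`Salmhofer1999`).
-/

noncomputable section

namespace Literature.MathematicalPhysics.QuantumLattice

open Literature.Probability.LatticeModels Literature.Analysis.Calculus Set Complex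

section IncrChain

variable {c θ Λ Λ' ω : ℝ}

/-- Elementary: `|(a + a′)³ − a³| ≤ |a′|·(3|a|² + 3|a||a′| + |a′|²)`. [cite: BenfattoGiulianiMastropietro2006, §3 (3.2)] -/
theorem abs_add_pow_three_sub_le (a a' : ℝ) : |(a + a') ^ 3 - a ^ 3| ≤ |a'| * (3 * |a| ^ 2 + 3 * |a| * |a'| + |a'| ^ 2) := by
  rw [show (a + a') ^ 3 - a ^ 3 = a' * (3 * a ^ 2 + 3 * a * a' + a' ^ 2) by ring, abs_mul]
  refine mul_le_mul_of_nonneg_left ?_ (abs_nonneg _)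
  calc |3 * a ^ 2 + 3 * a * a' + a' ^ 2| ≤ |3 * a ^ 2 + 3 * a * a'| + |a' ^ 2| := abs_add_le _ _
    _ ≤ (|3 * a ^ 2| + |3 * a * a'|) + |a' ^ 2| := add_le_add (abs_add_le _ _) le_rfl
    _ = 3 * |a| ^ 2 + 3 * |a| * |a'| + |a'| ^ 2 := by
        rw [abs_mul, abs_mul, abs_mul, abs_pow, abs_pow, abs_of_pos (by norm_num : (0:ℝ) < 3)]

/-- Elementary: `|(a + a′)(b + b′) − ab| ≤ |a||b′| + |a′||b| + |a′||b′|`. [cite: BenfattoGiulianiMastropietro2006, §3 (3.2)] -/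
theorem abs_add_mul_add_sub_le (a a' b b' : ℝ) : |(a + a') * (b + b') - a * b| ≤ |a| * |b'| + |a'| * |b| + |a'| * |b'| := by
  rw [show (a + a') * (b + b') - a * b = a * b' + a' * b + a' * b' by ring]
  calc _ ≤ |a * b' + a' * b| + |a' * b'| := abs_add_le _ _
    _ ≤ (|a * b'| + |a' * b|) + |a' * b'| := add_le_add (abs_add_le _ _) le_rfl
    _ = _ := by rw [abs_mul, abs_mul, abs_mul]

/-- **The order-three chain of the increment `Ψ̂∘(u+w) − Ψ̂∘u`**: with `G[v]` the chain of `hasDerivAt_chain3_comp` for the curve `v`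
(`v = u + w` with derivatives `u_i + w_i`, and `v = u`), the differences `H k = G[u+w] k − G[u] k` satisfy `HasDerivAt (H k) (H (k+1) t) t`
for `k < 3` (`0 < Λ ≤ Λ′`, `|θ| ≤ Λ/4`). [cite: BenfattoGiulianiMastropietro2006, (2.36aa)] -/
theorem hasDerivAt_sliceSymbolFnXi_incr_chain (hΛ : 0 < Λ) (hΛΛ' : Λ ≤ Λ') (hθ : |θ| ≤ Λ / 4) {u u₁ u₂ u₃ w w₁ w₂ w₃ : ℝ → ℝ}
    (hu : ∀ t, HasDerivAt u (u₁ t) t) (hu₁ : ∀ t, HasDerivAt u₁ (u₂ t) t) (hu₂ : ∀ t, HasDerivAt u₂ (u₃ t) t)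
    (hw : ∀ t, HasDerivAt w (w₁ t) t) (hw₁ : ∀ t, HasDerivAt w₁ (w₂ t) t) (hw₂ : ∀ t, HasDerivAt w₂ (w₃ t) t) :
    let Ψ := sliceSymbolFnXi c θ Λ Λ' ω
    let Ψ₁ := sliceSymbolFnXiD1 c θ Λ Λ' ω
    let Ψ₂ := sliceSymbolFnXiD2 c θ Λ Λ' ω
    let Ψ₃ := sliceSymbolFnXiD3 c θ Λ Λ' ω
    let H : ℕ → ℝ → ℂ := fun k t =>
      if k = 0 then Ψ (u t + w t) - Ψ (u t)
      else if k = 1 then Ψ₁ (u t + w t) * ((u₁ t + w₁ t : ℝ) : ℂ) - Ψ₁ (u t) * (u₁ t : ℂ)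
      else if k = 2 then (Ψ₂ (u t + w t) * ((u₁ t + w₁ t : ℝ) : ℂ) ^ 2 + Ψ₁ (u t + w t) * ((u₂ t + w₂ t : ℝ) : ℂ)) -
        (Ψ₂ (u t) * (u₁ t : ℂ) ^ 2 + Ψ₁ (u t) * (u₂ t : ℂ))
      else if k = 3 then (Ψ₃ (u t + w t) * ((u₁ t + w₁ t : ℝ) : ℂ) ^ 3 + 3 * (Ψ₂ (u t + w t) * ((u₁ t + w₁ t : ℝ) : ℂ) *
          ((u₂ t + w₂ t : ℝ) : ℂ)) + Ψ₁ (u t + w t) * ((u₃ t + w₃ t : ℝ) : ℂ)) -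
        (Ψ₃ (u t) * (u₁ t : ℂ) ^ 3 + 3 * (Ψ₂ (u t) * (u₁ t : ℂ) * (u₂ t : ℂ)) + Ψ₁ (u t) * (u₃ t : ℂ))
      else 0
    ∀ k < 3, ∀ t, HasDerivAt (H k) (H (k + 1) t) t := by
  intro Ψ Ψ₁ Ψ₂ Ψ₃ H k hk t
  have hv : ∀ s, HasDerivAt (fun s => u s + w s) (u₁ s + w₁ s) s := fun s => (hu s).add (hw s)
  have hv₁ : ∀ s, HasDerivAt (fun s => u₁ s + w₁ s) (u₂ s + w₂ s) s := fun s => (hu₁ s).add (hw₁ s)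
  have hv₂ : ∀ s, HasDerivAt (fun s => u₂ s + w₂ s) (u₃ s + w₃ s) s := fun s => (hu₂ s).add (hw₂ s)
  have hA := hasDerivAt_chain3_comp (g := Ψ) (g₁ := Ψ₁) (g₂ := Ψ₂) (g₃ := Ψ₃)
    (fun x => hasDerivAt_sliceSymbolFnXi hΛ hΛΛ' hθ x) (fun x => hasDerivAt_sliceSymbolFnXiD1 hΛ hΛΛ' hθ x)
    (fun x => hasDerivAt_sliceSymbolFnXiD2 hΛ hΛΛ' hθ x) hv hv₁ hv₂
  have hB := hasDerivAt_chain3_comp (g := Ψ) (g₁ := Ψ₁) (g₂ := Ψ₂) (g₃ := Ψ₃)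
    (fun x => hasDerivAt_sliceSymbolFnXi hΛ hΛΛ' hθ x) (fun x => hasDerivAt_sliceSymbolFnXiD1 hΛ hΛΛ' hθ x)
    (fun x => hasDerivAt_sliceSymbolFnXiD2 hΛ hΛΛ' hθ x) hu hu₁ hu₂
  interval_cases k
  · exact ((hA 0 (by norm_num) t).sub (hB 0 (by norm_num) t))
  · exact ((hA 1 (by norm_num) t).sub (hB 1 (by norm_num) t))
  · exact ((hA 2 (by norm_num) t).sub (hB 2 (by norm_num) t))

/-- **Pointwise bound of the third member of the increment chain.**  With the slice symbol's constants `K₁ = (16B₁+16)c/Λ²`,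
`K₂ = (32B₂+144B₁+128)c/Λ³`, `K₃ = (64B₃+480B₂+1728B₁+1536)c/Λ⁴`, an increment constant `K₄` for `Ψ̂‴` (hypothesis `hI3`), band data
`|u₁| ≤ D₁, |u₂| ≤ D₂, |u₃| ≤ D₃` and piece data `|w| ≤ W₀, |w₁| ≤ W₁, |w₂| ≤ W₂, |w₃| ≤ W₃` (all pointwise), the third member is at most
`K₄W₀(D₁+W₁)³ + K₃W₁(3D₁²+3D₁W₁+W₁²) + 3(K₃W₀(D₁+W₁)(D₂+W₂) + K₂(D₁W₂+W₁D₂+W₁W₂)) + K₂W₀(D₃+W₃) + K₁W₃`.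
[cite: BenfattoGiulianiMastropietro2006, §3 (3.2)] -/
theorem norm_sliceSymbolFnXi_incr_deriv3_le (hΛ : 0 < Λ) (hΛΛ' : Λ ≤ Λ') (hθ : |θ| ≤ Λ / 4) (hc : 0 ≤ c) {B₁ B₂ B₃ K₄ : ℝ}
    (hB₁ : ∀ x, |deriv salmhoferCutoff x| ≤ B₁) (hB₂ : ∀ x, |deriv (deriv salmhoferCutoff) x| ≤ B₂)
    (hB₃ : ∀ x, |deriv (deriv (deriv salmhoferCutoff)) x| ≤ B₃)
    (hI3 : ∀ x y, ‖sliceSymbolFnXiD3 c θ Λ Λ' ω (x + y) - sliceSymbolFnXiD3 c θ Λ Λ' ω x‖ ≤ K₄ * |y|)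
    {x y a b d a' b' d' : ℝ} {D₁ D₂ D₃ W₀ W₁ W₂ W₃ : ℝ}
    (ha : |a| ≤ D₁) (hb : |b| ≤ D₂) (hd : |d| ≤ D₃) (hy : |y| ≤ W₀) (ha' : |a'| ≤ W₁) (hb' : |b'| ≤ W₂) (hd' : |d'| ≤ W₃) :
    ‖(sliceSymbolFnXiD3 c θ Λ Λ' ω (x + y) * ((a + a' : ℝ) : ℂ) ^ 3 +
        3 * (sliceSymbolFnXiD2 c θ Λ Λ' ω (x + y) * ((a + a' : ℝ) : ℂ) * ((b + b' : ℝ) : ℂ)) +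
        sliceSymbolFnXiD1 c θ Λ Λ' ω (x + y) * ((d + d' : ℝ) : ℂ)) -
      (sliceSymbolFnXiD3 c θ Λ Λ' ω x * (a : ℂ) ^ 3 + 3 * (sliceSymbolFnXiD2 c θ Λ Λ' ω x * (a : ℂ) * (b : ℂ)) +
        sliceSymbolFnXiD1 c θ Λ Λ' ω x * (d : ℂ))‖ ≤
      K₄ * W₀ * (D₁ + W₁) ^ 3 + (64 * B₃ + 480 * B₂ + 1728 * B₁ + 1536) * c / Λ ^ 4 * (W₁ * (3 * D₁ ^ 2 + 3 * D₁ * W₁ + W₁ ^ 2)) +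
        3 * ((64 * B₃ + 480 * B₂ + 1728 * B₁ + 1536) * c / Λ ^ 4 * W₀ * ((D₁ + W₁) * (D₂ + W₂)) +
          (32 * B₂ + 144 * B₁ + 128) * c / Λ ^ 3 * (D₁ * W₂ + W₁ * D₂ + W₁ * W₂)) +
        ((32 * B₂ + 144 * B₁ + 128) * c / Λ ^ 3 * W₀ * (D₃ + W₃) + (16 * B₁ + 16) * c / Λ ^ 2 * W₃) := by
  have hB10 : 0 ≤ B₁ := (abs_nonneg _).trans (hB₁ 0)
  have hB20 : 0 ≤ B₂ := (abs_nonneg _).trans (hB₂ 0)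
  have hB30 : 0 ≤ B₃ := (abs_nonneg _).trans (hB₃ 0)
  have hK4 : 0 ≤ K₄ := by
    have h := hI3 0 1
    have : (0 : ℝ) ≤ K₄ * |(1:ℝ)| := (norm_nonneg _).trans h
    simpa using this
  set K₁ := (16 * B₁ + 16) * c / Λ ^ 2 with hK₁
  set K₂ := (32 * B₂ + 144 * B₁ + 128) * c / Λ ^ 3 with hK₂
  set K₃ := (64 * B₃ + 480 * B₂ + 1728 * B₁ + 1536) * c / Λ ^ 4 with hK₃
  have k1 : 0 ≤ K₁ := by rw [hK₁]; positivity
  have k2 : 0 ≤ K₂ := by rw [hK₂]; positivity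
  have k3 : 0 ≤ K₃ := by rw [hK₃]; positivity
  have hD1 : 0 ≤ D₁ := (abs_nonneg _).trans ha
  have hD2 : 0 ≤ D₂ := (abs_nonneg _).trans hb
  have hD3 : 0 ≤ D₃ := (abs_nonneg _).trans hd
  have hW0 : 0 ≤ W₀ := (abs_nonneg _).trans hy
  have hW1 : 0 ≤ W₁ := (abs_nonneg _).trans ha'
  have hW2 : 0 ≤ W₂ := (abs_nonneg _).trans hb'
  have hW3 : 0 ≤ W₃ := (abs_nonneg _).trans hd'
  have h := norm_chain3_three_sub_le (g₁ := sliceSymbolFnXiD1 c θ Λ Λ' ω) (g₂ := sliceSymbolFnXiD2 c θ Λ Λ' ω)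
    (g₃ := sliceSymbolFnXiD3 c θ Λ Λ' ω) (C₁ := K₁) (C₂ := K₂) (C₃ := K₃) (C₄ := K₄)
    (fun z => norm_sliceSymbolFnXiD1_le (ω := ω) hΛ hΛΛ' hθ hc hB₁ z) (fun z => norm_sliceSymbolFnXiD2_le (ω := ω) hΛ hΛΛ' hθ hc hB₁ hB₂ z)
    (fun z => norm_sliceSymbolFnXiD3_le (ω := ω) hΛ hΛΛ' hθ hc hB₁ hB₂ hB₃ z)
    (fun z z' => norm_sliceSymbolFnXiD1_sub_le (ω := ω) hΛ hΛΛ' hθ hc hB₁ hB₂ z z')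
    (fun z z' => norm_sliceSymbolFnXiD2_sub_le (ω := ω) hΛ hΛΛ' hθ hc hB₁ hB₂ hB₃ z z') hI3 x y a b d a' b' d'
  refine h.trans ?_
  -- bound each group
  have s1 : |a| + |a'| ≤ D₁ + W₁ := add_le_add ha ha'
  have s1' : 0 ≤ |a| + |a'| := by positivity
  have g1 : K₄ * |y| * (|a| + |a'|) ^ 3 ≤ K₄ * W₀ * (D₁ + W₁) ^ 3 :=
    mul_le_mul (mul_le_mul_of_nonneg_left hy hK4) (pow_le_pow_left₀ s1' s1 3) (by positivity) (by positivity)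
  have g2 : K₃ * |(a + a') ^ 3 - a ^ 3| ≤ K₃ * (W₁ * (3 * D₁ ^ 2 + 3 * D₁ * W₁ + W₁ ^ 2)) := by
    refine mul_le_mul_of_nonneg_left ((abs_add_pow_three_sub_le a a').trans ?_) k3
    refine mul_le_mul ha' ?_ (by positivity) hW1
    nlinarith [mul_le_mul ha ha (abs_nonneg a) hD1, mul_le_mul ha ha' (abs_nonneg a') hD1, mul_le_mul ha' ha' (abs_nonneg a') hW1,
      abs_nonneg a, abs_nonneg a']
  have g3 : K₃ * |y| * ((|a| + |a'|) * (|b| + |b'|)) ≤ K₃ * W₀ * ((D₁ + W₁) * (D₂ + W₂)) :=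
    mul_le_mul (mul_le_mul_of_nonneg_left hy k3) (mul_le_mul s1 (add_le_add hb hb') (by positivity) (by positivity))
      (by positivity) (by positivity)
  have g4 : K₂ * |(a + a') * (b + b') - a * b| ≤ K₂ * (D₁ * W₂ + W₁ * D₂ + W₁ * W₂) := by
    refine mul_le_mul_of_nonneg_left ((abs_add_mul_add_sub_le a a' b b').trans ?_) k2
    exact add_le_add (add_le_add (mul_le_mul ha hb' (abs_nonneg _) hD1) (mul_le_mul ha' hb (abs_nonneg _) hW1))
      (mul_le_mul ha' hb' (abs_nonneg _) hW1)
  have g5 : K₂ * |y| * (|d| + |d'|) ≤ K₂ * W₀ * (D₃ + W₃) :=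
    mul_le_mul (mul_le_mul_of_nonneg_left hy k2) (add_le_add hd hd') (by positivity) (by positivity)
  have g6 : K₁ * |d'| ≤ K₁ * W₃ := mul_le_mul_of_nonneg_left hd' k1
  have g34 : 3 * (K₃ * |y| * ((|a| + |a'|) * (|b| + |b'|)) + K₂ * |(a + a') * (b + b') - a * b|) ≤
      3 * (K₃ * W₀ * ((D₁ + W₁) * (D₂ + W₂)) + K₂ * (D₁ * W₂ + W₁ * D₂ + W₁ * W₂)) :=
    mul_le_mul_of_nonneg_left (add_le_add g3 g4) (by norm_num)
  linarith

/-- **Third differences of the increment along the line**: under the hypotheses of `norm_sliceSymbolFnXi_incr_deriv3_le` holding at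
EVERY point of the line (band data `D₁, D₂, D₃`, piece data `W₀, …, W₃`), for `δ ≥ 0`,
`‖Δ_δ³ (t ↦ Ψ̂(u t + w t) − Ψ̂(u t))(t)‖ ≤ δ³ · [the bound of norm_sliceSymbolFnXi_incr_deriv3_le]`. [cite: BenfattoGiulianiMastropietro2006, §3 (3.2)] -/
theorem norm_fwdDiff_iter_three_sliceSymbolFnXi_incr_le (hΛ : 0 < Λ) (hΛΛ' : Λ ≤ Λ') (hθ : |θ| ≤ Λ / 4) (hc : 0 ≤ c) {B₁ B₂ B₃ K₄ : ℝ}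
    (hB₁ : ∀ x, |deriv salmhoferCutoff x| ≤ B₁) (hB₂ : ∀ x, |deriv (deriv salmhoferCutoff) x| ≤ B₂)
    (hB₃ : ∀ x, |deriv (deriv (deriv salmhoferCutoff)) x| ≤ B₃)
    (hI3 : ∀ x y, ‖sliceSymbolFnXiD3 c θ Λ Λ' ω (x + y) - sliceSymbolFnXiD3 c θ Λ Λ' ω x‖ ≤ K₄ * |y|)
    {u u₁ u₂ u₃ w w₁ w₂ w₃ : ℝ → ℝ}
    (hu : ∀ t, HasDerivAt u (u₁ t) t) (hu₁ : ∀ t, HasDerivAt u₁ (u₂ t) t) (hu₂ : ∀ t, HasDerivAt u₂ (u₃ t) t)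
    (hw : ∀ t, HasDerivAt w (w₁ t) t) (hw₁ : ∀ t, HasDerivAt w₁ (w₂ t) t) (hw₂ : ∀ t, HasDerivAt w₂ (w₃ t) t)
    {D₁ D₂ D₃ W₀ W₁ W₂ W₃ : ℝ} (hD₁ : ∀ t, |u₁ t| ≤ D₁) (hD₂ : ∀ t, |u₂ t| ≤ D₂) (hD₃ : ∀ t, |u₃ t| ≤ D₃)
    (hW₀ : ∀ t, |w t| ≤ W₀) (hW₁ : ∀ t, |w₁ t| ≤ W₁) (hW₂ : ∀ t, |w₂ t| ≤ W₂) (hW₃ : ∀ t, |w₃ t| ≤ W₃) {δ : ℝ} (hδ : 0 ≤ δ) (t : ℝ) :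
    ‖(fwdDiff δ)^[3] (fun s => sliceSymbolFnXi c θ Λ Λ' ω (u s + w s) - sliceSymbolFnXi c θ Λ Λ' ω (u s)) t‖ ≤
      δ ^ 3 * (K₄ * W₀ * (D₁ + W₁) ^ 3 + (64 * B₃ + 480 * B₂ + 1728 * B₁ + 1536) * c / Λ ^ 4 * (W₁ * (3 * D₁ ^ 2 + 3 * D₁ * W₁ + W₁ ^ 2)) +
        3 * ((64 * B₃ + 480 * B₂ + 1728 * B₁ + 1536) * c / Λ ^ 4 * W₀ * ((D₁ + W₁) * (D₂ + W₂)) +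
          (32 * B₂ + 144 * B₁ + 128) * c / Λ ^ 3 * (D₁ * W₂ + W₁ * D₂ + W₁ * W₂)) +
        ((32 * B₂ + 144 * B₁ + 128) * c / Λ ^ 3 * W₀ * (D₃ + W₃) + (16 * B₁ + 16) * c / Λ ^ 2 * W₃)) := by
  set Ψ := sliceSymbolFnXi c θ Λ Λ' ω with hΨ
  set Ψ₁ := sliceSymbolFnXiD1 c θ Λ Λ' ω with hΨ₁
  set Ψ₂ := sliceSymbolFnXiD2 c θ Λ Λ' ω with hΨ₂
  set Ψ₃ := sliceSymbolFnXiD3 c θ Λ Λ' ω with hΨ₃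
  set H : ℕ → ℝ → ℂ := fun k t =>
      if k = 0 then Ψ (u t + w t) - Ψ (u t)
      else if k = 1 then Ψ₁ (u t + w t) * ((u₁ t + w₁ t : ℝ) : ℂ) - Ψ₁ (u t) * (u₁ t : ℂ)
      else if k = 2 then (Ψ₂ (u t + w t) * ((u₁ t + w₁ t : ℝ) : ℂ) ^ 2 + Ψ₁ (u t + w t) * ((u₂ t + w₂ t : ℝ) : ℂ)) -
        (Ψ₂ (u t) * (u₁ t : ℂ) ^ 2 + Ψ₁ (u t) * (u₂ t : ℂ))
      else if k = 3 then (Ψ₃ (u t + w t) * ((u₁ t + w₁ t : ℝ) : ℂ) ^ 3 + 3 * (Ψ₂ (u t + w t) * ((u₁ t + w₁ t : ℝ) : ℂ) *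
          ((u₂ t + w₂ t : ℝ) : ℂ)) + Ψ₁ (u t + w t) * ((u₃ t + w₃ t : ℝ) : ℂ)) -
        (Ψ₃ (u t) * (u₁ t : ℂ) ^ 3 + 3 * (Ψ₂ (u t) * (u₁ t : ℂ) * (u₂ t : ℂ)) + Ψ₁ (u t) * (u₃ t : ℂ))
      else 0 with hH
  have hchain : ∀ k < 3, ∀ t, HasDerivAt (H k) (H (k + 1) t) t :=
    hasDerivAt_sliceSymbolFnXi_incr_chain (c := c) (ω := ω) hΛ hΛΛ' hθ hu hu₁ hu₂ hw hw₁ hw₂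
  set K : ℝ := K₄ * W₀ * (D₁ + W₁) ^ 3 + (64 * B₃ + 480 * B₂ + 1728 * B₁ + 1536) * c / Λ ^ 4 * (W₁ * (3 * D₁ ^ 2 + 3 * D₁ * W₁ + W₁ ^ 2)) +
        3 * ((64 * B₃ + 480 * B₂ + 1728 * B₁ + 1536) * c / Λ ^ 4 * W₀ * ((D₁ + W₁) * (D₂ + W₂)) +
          (32 * B₂ + 144 * B₁ + 128) * c / Λ ^ 3 * (D₁ * W₂ + W₁ * D₂ + W₁ * W₂)) +
        ((32 * B₂ + 144 * B₁ + 128) * c / Λ ^ 3 * W₀ * (D₃ + W₃) + (16 * B₁ + 16) * c / Λ ^ 2 * W₃) with hK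
  have hbound : ∀ s, ‖H 3 s‖ ≤ K := by
    intro s
    have h3 : H 3 s = (Ψ₃ (u s + w s) * ((u₁ s + w₁ s : ℝ) : ℂ) ^ 3 + 3 * (Ψ₂ (u s + w s) * ((u₁ s + w₁ s : ℝ) : ℂ) *
          ((u₂ s + w₂ s : ℝ) : ℂ)) + Ψ₁ (u s + w s) * ((u₃ s + w₃ s : ℝ) : ℂ)) -
        (Ψ₃ (u s) * (u₁ s : ℂ) ^ 3 + 3 * (Ψ₂ (u s) * (u₁ s : ℂ) * (u₂ s : ℂ)) + Ψ₁ (u s) * (u₃ s : ℂ)) := by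
      simp [hH]
    rw [h3]
    exact norm_sliceSymbolFnXi_incr_deriv3_le hΛ hΛΛ' hθ hc hB₁ hB₂ hB₃ hI3 (hD₁ s) (hD₂ s) (hD₃ s) (hW₀ s) (hW₁ s) (hW₂ s) (hW₃ s)
  have h := Literature.Analysis.norm_fwdDiff_iter_le_of_hasDerivAt hδ 3 H t K (fun k hk s _ => hchain k hk s) (fun s _ => hbound s)
  have h0 : H 0 = fun s => Ψ (u s + w s) - Ψ (u s) := by funext s; simp [hH]
  rw [h0] at h
  exact h

end IncrChain

end Literature.MathematicalPhysics.QuantumLattice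

end
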